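import Literature.MathematicalPhysics.QuantumFieldTheory.BalabanImbrieJaffe1984to88.BIJ88GaugeAverage

/-!
# `BalabanImbrieJaffe1984to88.BIJ88RTIterated` — T. Bałaban, J. Imbrie, A. Jaffe, *Effective action and cluster properties of the
abelian Higgs model*, Commun. Math. Phys. **114** (1988) 257–315 [BalabanImbrieJaffe1988] and *Renormalization of the Higgs model:
minimizers, propagators and the stability of mean field theory*, Commun. Math. Phys. **97** (1985) 299–329 [BalabanImbrieJaffe1985]:
the renormalization transformation **(3.11)** = [BalabanImbrieJaffe1985] **(3.3)** ITERATED `k` TIMES — the density *"which is produced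
after k renormalization transformations"* ([BalabanImbrieJaffe1985] Sect. 4, p. 309) EXISTS at every level as an honest (everywhere
defined, exactly gauge invariant, integrable) function of the block fields, consecutive levels are related by the typed (3.11)
(`BIJ88RenormTransf311.IsRT311`), and the normalization **(3.13)**/(3.7) `∫dv dψ ρ_k(v, ψ) = ∫𝒟u𝒟φ ρ₀(u, φ) = [F]` holds after `k`
steps (p. 274: *"If we integrate this density over the u, φ variables, we obtain our original unnormalized expectation [F]"*).

statement-level skeleton of published theorems with citation tags; proofs where landed; nothing here is a claim about the Yang–Mills mass gap

PDF held: `paper:balaban1988-cmp114-bij-abelian-higgs-effective-action` (journal page = PDF page + 256), pp. 266–267 [PDF 10–11],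
274 [PDF 18], 277–278 [PDF 21–22] read this session (`lit read … --pages 18-22`, OCR + r18's renders
`HOME/lit-balaban-r18/renders/c2/c2-p010b.png`); `paper:balaban1985-cmp97-bij-higgs-minimizers` (journal page = PDF page + 298),
pp. 306–309 [PDF 8–11] (`lit read … --pages 7-11`).

CITATION HEADER (lean-in-tree rule).  Part of the lit-balaban TYPED SKELETON (HOME `run/shared/lean/pub/lit-balaban/`), PHASE-2
proof seat p34 gen 4 (unit `lit-balaban-p34-g4`; TAKING line HOME/STATUS.md 2026-08-21T05:13Z, typed-row protocol, own lineage =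
the C1/C2 renormalization-transformation line of seat p34: `BIJ85RT33` (3.3), `BIJ85RT37Normalization` (3.7), `BIJ88RT311Exists`
(3.11)-existence).  Rows served (fold owners r18 = C2 §§1–4, r15 = C1): `C2.Eq3.11` / `C2.Eq3.13` += k-fold, `C2.Eq4.17` += exactly
invariant versions, `C2.Eq4.1` (the p. 274 sentence, for the composed transformation), `C1.Eq3.1-3.3` / `C1.Eq3.7` += `𝒯` iterated;
it is r18 gen 4's hand-off item *"k-fold Haar law / multi-step block gauge invariance"* (HOME/lit-balaban-r18/HANDOFF.md).

THE PRINTED TEXT.  [BalabanImbrieJaffe1985] p. 306 [PDF 8]: *"The renormalization transformation R defines a mapping R : S → S^{(1)},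
(3.1) where S, S^{(1)} are both unit lattice actions. … (𝒯e^{−S})(v, ψ) = ∫ e^{−S(u,φ)} δ_{Ax}(u) δ(v/Qu) δ_H(ψ − Qφ) 𝒟u𝒟φ. (3.3) …
Let 𝒢₀ denote the subgroup of gauge transformations … which are constant on each L-block B(y). These gauge transformations preserve
the axial gauge and affect only bonds on the unit lattice which connect different blocks. They generate the gauge group of the integral
𝒯(exp −S). … The integral (3.2) therefore has the normalization property ∫ 𝒯e^{−S} 𝒟v𝒟ψ = ∫ e^{−S} 𝒟u𝒟φ, (3.7)"*; p. 309 [PDF 11]: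
*"4. Form of the kth Effective Action.  In this section we state the quadratic or mean field approximation to the action which is produced
after k renormalization transformations."*  [BalabanImbrieJaffe1988] p. 266 [PDF 10]: *"This is the renormalization transformation,
described in the previous paper. With the gauge fix δ_{Ax}(u), it takes the density ρ₀(u, φ) to ρ₁^L(v, ψ) = … (3.11) … which normalizes
the transformation so that [F] = ∫dv dψ ρ₁^L(v, ψ). (3.13)"*; p. 274 [PDF 18], on the k-step density (4.1): *"If we integrate this density
over the u, φ variables, we obtain our original unnormalized expectation [F]. The measure du^{(j)} is the normalized measure on U(1),
∫du^{(j)} = 1."*; p. 277 [PDF 21], (4.17): *"block field gauge invariance … u_b → u_be^{−ie_k(∂λ)(b)}, φ(x) → e^{ie_kλ(x)}[φ] … and thus we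
have invariance in the previous sense"*, *"since the measure dφ^{(j)} is rotationally invariant, no account need be made of these
rotations"*; p. 278 [PDF 22]: *"Under gauge transformations λ of u, φ, u^{(j)} … we see that the δ-functions and ρ′_k are invariant. …
Thus no change is made if we insert the axial gauge conditions δ_{Ax}(u) = Π_{y∈T₁^{(k)′}} Π_{x∈B(y),x≠y} δ(u(Γ_{y,x})) (5.1.4)"*.

WHAT IS PROVED HERE (model instance: the torus carrier of record `Balaban1983to89.Setup`, the PRINTED block averages `Qu` (2.10) /
`Q(u)φ` (2.6) of r18's `BIJ85BlockAveragesTorus` (`torusRTData`), r18's axial forest `axialBonds` = `δ_{Ax}` and normalized Gaussian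
`gaussWeight` (3.11)–(3.12) (`gaussApprox`), p34 gen 2's Radon–Nikodym transform `BIJ85RT33.RTData.rt` = (3.3); file 2/2 of seat p34
gen 4 — file 1/2 `BIJ88GaugeAverage` supplies the gauge average `gaugeAvg` (the exactly invariant VERSION of an a.e.-invariant density,
`gaugeAvg_ae_eq`) and the a.e.-congruence of (3.11) `isRT311_congr_ae`).
§3  ONE STEP at any level `i` (standing range `i + 1 ≤ m + K`, `a > 0`, `d ≥ 2`): for `ρ` jointly measurable, jointly gauge invariant and
    `𝒟u𝒟φ`-integrable, `rtStep ρ := gaugeAvg (𝒯ρ)` is again jointly measurable, jointly gauge invariant, integrable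
    (`measurable_rtStep`, `jointInvariant_rtStep`, `integrable_rtStep`), is a VERSION of `𝒯ρ` (`rtStep_ae_eq_rt`, from r18's (4.17)
    `rt_blockGauge_ae_eq`), satisfies the typed (3.11) `IsRT311 Qu Q(·)φ a ρ (rtStep ρ)` (`isRT311_rtStep`, from r18's `isRT311_model`)
    and the normalization (3.13)/(3.7) `∫dv dψ (rtStep ρ) = ∫𝒟u𝒟φ ρ` (`integral_rtStep`, r18's `integral_eq_of_isRT311`).
§4  `k` STEPS (`rtIter ρ₀ k` at level `j + k`, step-dependent Gaussian parameters `a_n > 0`): by induction every iterate is jointly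
    measurable, jointly gauge invariant and integrable (`rtIter_regular`; `measurable_rtIter`, `jointInvariant_rtIter`, `integrable_rtIter`),
    consecutive iterates satisfy (3.11) (`isRT311_rtIter_succ`) with `ρ_{k+1}` a version of `𝒯ρ_k` (`rtIter_succ_ae_eq_rt`), and
    **`∫dv dψ ρ_k = ∫𝒟u𝒟φ ρ₀`** (`integral_rtIter`) — whence, for the model's `ρ₀ = F e^{−S}` (r18's `rho0`) and the observables of (3.1)
    (jointly measurable, gauge invariant, `|F| ≤ CΠ_x(1 + |φ(x)|)ⁿ`; integrability by r18's `BIJ88Rho0Integrable.integrable_rho0`),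
    **`[F] = ∫dv dψ ρ_k(v, ψ)` after `k` renormalization transformations** (`bracket_eq_integral_rtIter`) — the p. 274 sentence for the
    composed transformation.
NOT DONE HERE (honest scope).  (i) The general-step transformation (5.1.1) p. 277 integrates the scalar constraint against the BACKGROUND
field, `exp[−½aL⁻²⟨ψ − Q(u_k)φ, ψ − Q(u_k)φ⟩ − E^{(k)}]` with `u_k` of (4.2) a function of `u` AND of the earlier fluctuation fields
`u^{(j)}`, and acts on `ρ′_k(u, φ, {X_ω}, {u^{(j)})` before the `u^{(j)}`-integrations; the object iterated here is the (3.11)/(3.3)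
transformation with the kernel `Q(u)φ` at every level (C1's `R^k` without the rescalings), not (5.1.1) verbatim.  (ii) The rescaling
`𝒮_L` of [BalabanImbrieJaffe1985] (3.2) `R = 𝒮_L𝒯` / the `ψ`-scaling (5.15.3) between steps is not inserted (in the `Setup` tower the
next level's lattice is the block lattice itself; the scalar rescaling is a constant Jacobian).  (iii) No bound, no small/large-field
analysis.  Uses BY NAME: r18's `isRT311_model`, `rt_blockGauge_ae_eq`, `integral_eq_of_isRT311`, `bracket_eq_integral_rho0`, `integrable_rho0`;
p34 gen 2's `integrable_rt`, `gaugeInvariant_integral`; file 1/2 `BIJ88GaugeAverage`.  Re-declares nothing; imports Literature + Mathlib only; no `Prop`-valued fact is introduced; standard axioms.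

v1.1 (append-only, same seat): §5 THE SCALING `𝒮_L` between steps ([BalabanImbrieJaffe1985] (3.2) `R = 𝒮_L𝒯`; p. 313 [PDF 57] *"We now scale this
density from T_L^{(k+1)} to T₁^{(k+1)}, putting ψ^L(y) = L^{−(d−2)/2}ψ¹(L⁻¹y) … then the integral of ρ(v, ψ¹) is equal to the integral of
ρ^L(v, ψ^L)"*, (5.15.3); p. 273 (3.42)–(3.43)): `scaleStep c ρ (v, ψ¹) := c^{2|T|} ρ(v, cψ¹)` with the Jacobian `c^{2|T|}` of `ψ ↦ cψ` on
`ℂ^{T}` — integral preserved for every `c > 0` (`integral_scaleStep`, `integral_integral_scaleStep`), jointly gauge invariant / measurable /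
integrable with `ρ`; the full step `rgStep := scaleStep c ∘ rtStep` = `R = 𝒮𝒯` keeps measurability, exact gauge invariance, integrability and
the total integral (`rgStep_regular`); **`scaleJac_eq_exp_neg_E0prime`**: for the printed `c = L^{−(d−2)/2}` the Jacobian is `exp(−E^{(0)′})`
with `E^{(0)′} = (d−2)(log L)|T₁|` = r18's `E0prime` **(3.42)**; TRANSCRIPT NOTE (HOME/GAPS.md G-C2-08, kernel witness `scaleJac_ne_printed5153`):
(5.15.3) p. 313 prints the increment `((d−2)/2)(log L)|T₁^{(k+1)}|`, half of what (3.42)–(3.43) (its `k = 0` instance) and the Jacobian on the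
complex block field give; the typed scaling carries the honest Jacobian, r16's verbatim `BIJ88Sect5Statements.normEnergy` (5.15.3) is untouched.
Item (ii) of NOT DONE HERE above is thereby done for the scalar field; v1.1 adds `E0prime` to an `open` line; nothing of v1 is changed.

v1.2 (append-only, same seat): §6 `R^k` — the full step `R = 𝒮𝒯` of [BalabanImbrieJaffe1985] (3.1)–(3.2) ITERATED `k` times (`rgIter`, Gaussian parameters
`a_n > 0`, scalings `c_n > 0`): `rgIter_regular` (every iterate jointly measurable ∧ exactly jointly gauge invariant ∧ integrable ∧ `∫dv dψ R^kρ₀ =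
∫𝒟u𝒟φ ρ₀`) and `bracket_eq_integral_rgIter` (`[F] = ∫dv dψ (R^kρ₀)(v, ψ)` for the model and the (3.1) observables); nothing of v1/v1.1 is changed.
-/

namespace Literature.MathematicalPhysics.QuantumFieldTheory.BalabanImbrieJaffe1984to88.BIJ88RTIterated

open Literature.MathematicalPhysics.QuantumFieldTheory.Balaban1983to89
open BIJ88Sect3Statements (U1 toC toC_mul toC_one toC_inv norm_toC bracket actionU1 E0prime)
open BIJ85Sect1Model (HiggsField)
open BIJ85RT33 (JointInvariant gaugeInvariant_integral)
open BIJ88RenormTransf311 (IsRT311 rho0 integral_eq_of_isRT311 measurable_rho0 rho0_gaugeAct bracket_eq_integral_rho0)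
open BIJ85BlockAveragesTorus (qU qCov torusRTData isRT311_model)
open BIJ88RT311Exists (gaussApprox)
open BIJ88BlockGauge417 (rt_blockGauge_ae_eq)
open BIJ88GaugeAverage (gaugeAvg jointInvariant_gaugeAvg measurable_gaugeAvg integrable_gaugeAvg gaugeAvg_ae_eq isRT311_congr_ae
  measurable_rt)
open GaugeField (gaugeAct GaugeInvariant)
open scoped BigOperators ENNReal
open _root_.MeasureTheory _root_.MeasureTheory.Measure Complex Function

noncomputable section

variable {P : Params} {j : ℕ}

/-! ## §3 ONE renormalization step at level `i`: `ρ ↦ gaugeAvg(𝒯ρ)` -/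

/-- The densities of a level: functions of the gauge field `u : bonds → U(1)` and the scalar field `φ : sites → ℂ` of `T₁^{(i)}`.
[cite: BalabanImbrieJaffe1988, (3.11) p.266] -/
abbrev Dens (P : Params) (i : ℕ) : Type := GaugeField P i U1 → HiggsField P i → ℂ

section Step

variable {i : ℕ}

/-- **One renormalization step** `ρ ↦ ρ′ := gaugeAvg(𝒯ρ)`: the Radon–Nikodym transform (3.3)/(3.11) of `ρ` over the printed block
averages (r18's `torusRTData`: `δ_{Ax}` = `axialBonds`, `Qu` (2.10), `Q(u)φ` (2.6); `δ_H` = the normalized Gaussian (3.11)–(3.12),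
parameter `a`), followed by the gauge average of `BIJ88GaugeAverage` (an a.e.-null modification, `rtStep_ae_eq_rt`).
[cite: BalabanImbrieJaffe1988, (3.11) p.266] -/
def rtStep (hi : i + 1 ≤ P.m + P.K) {a : ℝ} (ha : 0 < a) (hd : 2 ≤ P.d) (ρ : Dens P i) : Dens P (i + 1) :=
  gaugeAvg ((torusRTData hi).rt (gaussApprox ha hd) ρ)

variable (hi : i + 1 ≤ P.m + P.K) {a : ℝ} (ha : 0 < a) (hd : 2 ≤ P.d) {ρ : Dens P i}

/-- **The step is a VERSION of `𝒯ρ`**: `rtStep ρ = 𝒯ρ` for `dv dψ`-a.e. `(v, ψ)` (r18's (4.17) `rt_blockGauge_ae_eq` feeds `gaugeAvg_ae_eq`),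
for `ρ` jointly measurable, jointly gauge invariant and `𝒟u𝒟φ`-integrable. [cite: BalabanImbrieJaffe1988, (4.17) p.277] -/
theorem rtStep_ae_eq_rt (hρm : Measurable (uncurry ρ)) (hρg : JointInvariant ρ)
    (hρi : Integrable (uncurry ρ) ((fieldMeasure P i U1).prod volume)) :
    uncurry (rtStep hi ha hd ρ) =ᵐ[(fieldMeasure P (i+1) U1).prod volume]
      uncurry ((torusRTData hi).rt (gaussApprox ha hd) ρ) :=
  gaugeAvg_ae_eq (measurable_rt _ _ _) fun g => rt_blockGauge_ae_eq hi ha hd hρm hρg hρi g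

/-- kernel: the step is jointly measurable. [cite: BalabanImbrieJaffe1988, (3.11) p.266] -/
theorem measurable_rtStep : Measurable (uncurry (rtStep hi ha hd ρ)) :=
  measurable_gaugeAvg (measurable_rt _ _ _)

/-- **The step is EXACTLY jointly gauge invariant** — (4.17) *"leave each expression invariant"* for the renormalized density, on the
nose. [cite: BalabanImbrieJaffe1988, (4.17) p.277] -/
theorem jointInvariant_rtStep : JointInvariant (rtStep hi ha hd ρ) :=
  jointInvariant_gaugeAvg _

/-- **The step is `dv dψ`-integrable** (p34 gen 2's `integrable_rt` + `integrable_gaugeAvg`). [cite: BalabanImbrieJaffe1988, (3.11) p.266] -/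
theorem integrable_rtStep (hρm : Measurable (uncurry ρ)) (hρg : JointInvariant ρ)
    (hρi : Integrable (uncurry ρ) ((fieldMeasure P i U1).prod volume)) :
    Integrable (uncurry (rtStep hi ha hd ρ)) ((fieldMeasure P (i+1) U1).prod volume) :=
  integrable_gaugeAvg (measurable_rt _ _ _)
    (BIJ85RT37Normalization.integrable_rt (D := torusRTData hi) (A := gaussApprox ha hd) hρm hρg hρi)

/-- **(3.11) for the step**: `IsRT311 Q Q(·)φ a ρ (rtStep ρ)` with the printed block averages (r18's `isRT311_model` transported along
the a.e. equality `rtStep_ae_eq_rt`). [cite: BalabanImbrieJaffe1988, (3.11) p.266] -/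
theorem isRT311_rtStep (hρm : Measurable (uncurry ρ)) (hρg : JointInvariant ρ)
    (hρi : Integrable (uncurry ρ) ((fieldMeasure P i U1).prod volume)) :
    IsRT311 qU qCov a ρ (rtStep hi ha hd ρ) :=
  isRT311_congr_ae (isRT311_model hi ha hd hρm hρg hρi)
    (BIJ85RT37Normalization.integrable_rt (D := torusRTData hi) (A := gaussApprox ha hd) hρm hρg hρi)
    (integrable_rtStep hi ha hd hρm hρg hρi) (rtStep_ae_eq_rt hi ha hd hρm hρg hρi)

/-- **(3.13)/(3.7) for the step**: `∫dv dψ (rtStep ρ)(v, ψ) = ∫𝒟u𝒟φ ρ(u, φ)` (r18's `integral_eq_of_isRT311`; the gauge invariance of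
`u ↦ ∫𝒟φ ρ(u, φ)` from the joint invariance by p34 gen 2's `gaugeInvariant_integral`). [cite: BalabanImbrieJaffe1988, (3.13) p.267] -/
theorem integral_rtStep (hρm : Measurable (uncurry ρ)) (hρg : JointInvariant ρ)
    (hρi : Integrable (uncurry ρ) ((fieldMeasure P i U1).prod volume)) :
    ∫ v, ∫ ψ, rtStep hi ha hd ρ v ψ ∂volume ∂fieldMeasure P (i+1) U1 = ∫ U, ∫ φ, ρ U φ ∂volume ∂fieldMeasure P i U1 :=
  integral_eq_of_isRT311 hi hd ha (isRT311_rtStep hi ha hd hρm hρg hρi) hρm (gaugeInvariant_integral hρm hρg)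

end Step

/-! ## §4 `k` renormalization steps: *"the action which is produced after k renormalization transformations"* -/

/-- **The k-fold renormalization transformation** `ρ_k` at level `j + k` of a density `ρ₀` at level `j`: `ρ₀`, then `ρ_{n+1} = rtStep ρ_n`
with the Gaussian parameter `a_n` of the `n`-th step ([BalabanImbrieJaffe1985] p. 309: *"after k renormalization transformations"*;
[BalabanImbrieJaffe1988] Sect. 5: step `k` to `k + 1`).  Standing range: `j + k ≤ m + K`. [cite: BalabanImbrieJaffe1988, (4.1) p.274] -/
def rtIter (a : ℕ → ℝ) (ha : ∀ n, 0 < a n) (hd : 2 ≤ P.d) (ρ₀ : Dens P j) : (k : ℕ) → j + k ≤ P.m + P.K → Dens P (j + k)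
  | 0, _ => ρ₀
  | k + 1, hk => rtStep (i := j + k) hk (ha k) hd (rtIter a ha hd ρ₀ k (Nat.le_of_succ_le hk))

section Iter

variable (a : ℕ → ℝ) (ha : ∀ n, 0 < a n) (hd : 2 ≤ P.d) {ρ₀ : Dens P j}

/-- kernel: no step is the identity. [cite: BalabanImbrieJaffe1988, (4.1) p.274] -/
theorem rtIter_zero (h : j + 0 ≤ P.m + P.K) : rtIter a ha hd ρ₀ 0 h = ρ₀ := rfl

/-- kernel: the `(k+1)`-st iterate is one step applied to the `k`-th. [cite: BalabanImbrieJaffe1988, (4.1) p.274] -/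
theorem rtIter_succ (k : ℕ) (hk : j + (k + 1) ≤ P.m + P.K) :
    rtIter a ha hd ρ₀ (k + 1) hk = rtStep (i := j + k) hk (ha k) hd (rtIter a ha hd ρ₀ k (Nat.le_of_succ_le hk)) := rfl

/-- **Induction**: every iterate is jointly measurable, jointly gauge invariant and integrable, provided `ρ₀` is.
[cite: BalabanImbrieJaffe1988, (4.1) p.274] -/
theorem rtIter_regular (hρm : Measurable (uncurry ρ₀)) (hρg : JointInvariant ρ₀)
    (hρi : Integrable (uncurry ρ₀) ((fieldMeasure P j U1).prod volume)) (k : ℕ) (hk : j + k ≤ P.m + P.K) :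
    Measurable (uncurry (rtIter a ha hd ρ₀ k hk)) ∧ JointInvariant (rtIter a ha hd ρ₀ k hk) ∧
      Integrable (uncurry (rtIter a ha hd ρ₀ k hk)) ((fieldMeasure P (j + k) U1).prod volume) := by
  induction k with
  | zero => exact ⟨hρm, hρg, hρi⟩
  | succ k ih =>
    obtain ⟨hm, hg, hint⟩ := ih (Nat.le_of_succ_le hk)
    exact ⟨measurable_rtStep hk (ha k) hd, jointInvariant_rtStep hk (ha k) hd, integrable_rtStep hk (ha k) hd hm hg hint⟩

/-- kernel: the `k`-th iterate is jointly measurable. [cite: BalabanImbrieJaffe1988, (4.1) p.274] -/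
theorem measurable_rtIter (hρm : Measurable (uncurry ρ₀)) (hρg : JointInvariant ρ₀)
    (hρi : Integrable (uncurry ρ₀) ((fieldMeasure P j U1).prod volume)) (k : ℕ) (hk : j + k ≤ P.m + P.K) :
    Measurable (uncurry (rtIter a ha hd ρ₀ k hk)) :=
  (rtIter_regular a ha hd hρm hρg hρi k hk).1

/-- **The `k`-th renormalized density is EXACTLY jointly gauge invariant** ((4.17) after `k` steps).
[cite: BalabanImbrieJaffe1988, (4.17) p.277] -/
theorem jointInvariant_rtIter (hρm : Measurable (uncurry ρ₀)) (hρg : JointInvariant ρ₀)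
    (hρi : Integrable (uncurry ρ₀) ((fieldMeasure P j U1).prod volume)) (k : ℕ) (hk : j + k ≤ P.m + P.K) :
    JointInvariant (rtIter a ha hd ρ₀ k hk) :=
  (rtIter_regular a ha hd hρm hρg hρi k hk).2.1

/-- **The `k`-th renormalized density is `dv dψ`-integrable.** [cite: BalabanImbrieJaffe1988, (4.1) p.274] -/
theorem integrable_rtIter (hρm : Measurable (uncurry ρ₀)) (hρg : JointInvariant ρ₀)
    (hρi : Integrable (uncurry ρ₀) ((fieldMeasure P j U1).prod volume)) (k : ℕ) (hk : j + k ≤ P.m + P.K) :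
    Integrable (uncurry (rtIter a ha hd ρ₀ k hk)) ((fieldMeasure P (j + k) U1).prod volume) :=
  (rtIter_regular a ha hd hρm hρg hρi k hk).2.2

/-- **Consecutive iterates are related by the typed (3.11)** with the printed block averages and the `k`-th Gaussian parameter:
`IsRT311 Q Q(·)φ a_k ρ_k ρ_{k+1}` — step `k → k + 1` of Sect. 5 in the push-forward reading. [cite: BalabanImbrieJaffe1988, (3.11) p.266] -/
theorem isRT311_rtIter_succ (hρm : Measurable (uncurry ρ₀)) (hρg : JointInvariant ρ₀)
    (hρi : Integrable (uncurry ρ₀) ((fieldMeasure P j U1).prod volume)) (k : ℕ) (hk : j + (k + 1) ≤ P.m + P.K) :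
    IsRT311 qU qCov (a k) (rtIter a ha hd ρ₀ k (Nat.le_of_succ_le hk)) (rtIter a ha hd ρ₀ (k + 1) hk) := by
  obtain ⟨hm, hg, hint⟩ := rtIter_regular a ha hd hρm hρg hρi k (Nat.le_of_succ_le hk)
  exact isRT311_rtStep hk (ha k) hd hm hg hint

/-- **The `(k+1)`-st iterate is a VERSION of `𝒯ρ_k`** (the Radon–Nikodym transform of the `k`-th over the printed averages), `dv dψ`-a.e.
[cite: BalabanImbrieJaffe1988, (3.11) p.266] -/
theorem rtIter_succ_ae_eq_rt (hρm : Measurable (uncurry ρ₀)) (hρg : JointInvariant ρ₀)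
    (hρi : Integrable (uncurry ρ₀) ((fieldMeasure P j U1).prod volume)) (k : ℕ) (hk : j + (k + 1) ≤ P.m + P.K) :
    uncurry (rtIter a ha hd ρ₀ (k + 1) hk) =ᵐ[(fieldMeasure P (j + k + 1) U1).prod volume]
      uncurry ((torusRTData hk).rt (gaussApprox (ha k) hd) (rtIter a ha hd ρ₀ k (Nat.le_of_succ_le hk))) := by
  obtain ⟨hm, hg, hint⟩ := rtIter_regular a ha hd hρm hρg hρi k (Nat.le_of_succ_le hk)
  exact rtStep_ae_eq_rt hk (ha k) hd hm hg hint

/-- **NORMALIZATION AFTER `k` STEPS**: `∫dv dψ ρ_k(v, ψ) = ∫𝒟u𝒟φ ρ₀(u, φ)` — (3.13)/[BalabanImbrieJaffe1985] (3.7) composed `k` times.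
[cite: BalabanImbrieJaffe1988, (3.13) p.267] -/
theorem integral_rtIter (hρm : Measurable (uncurry ρ₀)) (hρg : JointInvariant ρ₀)
    (hρi : Integrable (uncurry ρ₀) ((fieldMeasure P j U1).prod volume)) (k : ℕ) (hk : j + k ≤ P.m + P.K) :
    ∫ v, ∫ ψ, rtIter a ha hd ρ₀ k hk v ψ ∂volume ∂fieldMeasure P (j + k) U1 = ∫ U, ∫ φ, ρ₀ U φ ∂volume ∂fieldMeasure P j U1 := by
  induction k with
  | zero => rfl
  | succ k ih =>
    obtain ⟨hm, hg, hint⟩ := rtIter_regular a ha hd hρm hρg hρi k (Nat.le_of_succ_le hk)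
    exact (integral_rtStep hk (ha k) hd hm hg hint).trans (ih (Nat.le_of_succ_le hk))

/-- **p. 274, for the composed transformation: *"If we integrate this density over the u, φ variables, we obtain our original unnormalized
expectation [F]"*** — for the MODEL: `ρ₀ = F e^{−S}` (r18's `rho0`: the `ε`-lattice action (3.3) at the rescaled scalar field, (3.6)–(3.7))
with `ε > 0`, `λ > 0`, every observable `F` of (3.1) (jointly measurable, jointly gauge invariant, `|F(u, φ)| ≤ CΠ_x(1 + |φ(x)|)ⁿ`), Gaussian
parameters `a_n > 0`, `d ≥ 2`, standing range `j + k ≤ m + K`:  `[F] = ∫dv dψ ρ_k(v, ψ)` after `k` renormalization transformations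
(`integral_rtIter` ∘ r18's `bracket_eq_integral_rho0`, integrability by r18's `BIJ88Rho0Integrable.integrable_rho0`).
[cite: BalabanImbrieJaffe1988, (4.1) p.274] -/
theorem bracket_eq_integral_rtIter {ε : ℝ} (hε : 0 < ε) (e : ℝ) {lam : ℝ} (hlam : 0 < lam) (dm2 E₀ E₁ : ℝ)
    {F : GaugeField P j U1 → HiggsField P j → ℂ} (hFm : Measurable (uncurry F)) (hFg : JointInvariant F) {C : ℝ} {n : ℕ}
    (hF : ∀ U φ, ‖F U φ‖ ≤ C * ∏ x : Balaban1983to89.Site P j, (1 + ‖φ x‖) ^ n) (k : ℕ) (hk : j + k ≤ P.m + P.K) :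
    bracket (actionU1 (ε ^ P.d) ε⁻¹ e lam dm2 E₀ E₁) F =
      ∫ v, ∫ ψ, rtIter a ha hd (rho0 ε e lam dm2 E₀ E₁ F) k hk v ψ ∂volume ∂fieldMeasure P (j + k) U1 := by
  rw [bracket_eq_integral_rho0 hε, integral_rtIter a ha hd (measurable_rho0 ε e lam dm2 E₀ E₁ hFm)
    (fun g U φ => rho0_gaugeAct ε e lam dm2 E₀ E₁ hFg g U φ) (BIJ88Rho0Integrable.integrable_rho0 hε e hlam dm2 E₀ E₁ hFm hF) k hk]

end Iter

/-! ## §5 (v1.1) The scaling `𝒮_L` between steps: [BalabanImbrieJaffe1985] (3.2) `R = 𝒮_L𝒯`, [BalabanImbrieJaffe1988] (3.42)–(3.43), (5.15.3)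

p. 313 [PDF 57], verbatim: *"We now scale this density from T_L^{(k+1)} to T₁^{(k+1)}, putting ψ^L(y) = L^{−(d−2)/2}ψ¹(L⁻¹y). If we define
ρ(v, ψ¹) = exp[−((d−2)/2)(log L)|T₁^{(k+1)}|] ρ^L(v, L^{−(d−2)/2}ψ¹), then the integral of ρ(v, ψ¹) is equal to the integral of
ρ^L(v, ψ^L). Thus we define the (k+1)th normalizing energy to be ℰ_{k+1} = ℰ_k + E^{(k)} + ((d−2)/2)(log L)|T₁^{(k+1)}|. (5.15.3)"*;
p. 273 [PDF 17]: *"We rescale the L-lattice of blocks to unit lattice spacing. From the block field ψ we get a contribution to the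
normalization energy: E^{(0)′} = (d−2)(log L)|T₁^{(1)}|, (3.42) and we put ℰ₁ = ℰ₀ + E^{(0)} + E^{(0)′}. (3.43)"*.
In the `Setup` tower the sites of `T_L^{(k+1)}` and of `T₁^{(k+1)}` are the same type (level `i`), so `𝒮_L` acts on the scalar field
only: `(𝒮ρ)(v, ψ) = J · ρ(v, cψ)` with `c = L^{−(d−2)/2}` and `J` the Jacobian of `ψ ↦ cψ` on `ℂ^{T}` — which is `c^{2|T|} =
exp[−(d−2)(log L)|T|] = e^{−E^{(0)′}}` with the exponent of **(3.42)**, the scalar field having TWO real components per site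
(p34 gen 1's `BIJ88Sect3Rescaling.finrank_higgsField`); the `½` printed in (5.15.3) is recorded as a transcript note (HOME/GAPS.md G-C2-08; kernel witness
`scaleJac_ne_printed5153`), the typed scaling uses the honest Jacobian. -/

section Scale

variable {i : ℕ}

/-- **The scaling `𝒮` of the block scalar field** ([BalabanImbrieJaffe1985] (3.2) `R = 𝒮_L𝒯`; [BalabanImbrieJaffe1988] p. 313): `(𝒮_cρ)(v, ψ¹) =
c^{2|T|} ρ(v, cψ¹)`, the density in the rescaled field `ψ¹` (`ψ^L = cψ¹`, printed `c = L^{−(d−2)/2}`) carrying the Jacobian `c^{2|T|}` of the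
substitution. [cite: BalabanImbrieJaffe1988, (5.15.3) p.313] -/
def scaleStep (c : ℝ) (ρ : Dens P i) : Dens P i := fun v ψ => ((c ^ Module.finrank ℝ (HiggsField P i) : ℝ) : ℂ) * ρ v (c • ψ)

/-- **p. 313: *"then the integral of ρ(v, ψ¹) is equal to the integral of ρ^L(v, ψ^L)"*** — PROVED for the scaling with the Jacobian
`c^{2|T|}` (every `c > 0`, every density, every `v`; p34 gen 1's `BIJ88Sect3Rescaling.integral_comp_smul_jac` = Mathlib's
`Measure.integral_comp_smul`). [cite: BalabanImbrieJaffe1988, (5.15.3) p.313] -/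
theorem integral_scaleStep {c : ℝ} (hc : 0 < c) (ρ : Dens P i) (v : GaugeField P i U1) :
    ∫ ψ, scaleStep c ρ v ψ = ∫ ψ, ρ v ψ := by
  unfold scaleStep
  rw [BIJ88Sect3Rescaling.integral_comp_smul_jac (ρ v) hc]
  refine integral_congr_ae (Filter.Eventually.of_forall fun ψ => ?_)
  simp only [Complex.real_smul]

/-- Hence `∫dv dψ¹ (𝒮ρ)(v, ψ¹) = ∫dv dψ ρ(v, ψ)`: the scaling preserves the normalization (3.13). [cite: BalabanImbrieJaffe1988, (5.15.3) p.313] -/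
theorem integral_integral_scaleStep {c : ℝ} (hc : 0 < c) (ρ : Dens P i) :
    ∫ v, ∫ ψ, scaleStep c ρ v ψ ∂volume ∂fieldMeasure P i U1 = ∫ v, ∫ ψ, ρ v ψ ∂volume ∂fieldMeasure P i U1 := by
  simp_rw [integral_scaleStep hc]

/-- kernel: the scaling commutes with the gauge rotations `ψ ↦ gψ`, so `𝒮ρ` is jointly gauge invariant with `ρ`.
[cite: BalabanImbrieJaffe1988, (4.17) p.277] -/
theorem jointInvariant_scaleStep (c : ℝ) {ρ : Dens P i} (hρg : JointInvariant ρ) : JointInvariant (scaleStep c ρ) := by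
  intro g v ψ
  unfold scaleStep
  have htw : c • BIJ85RT33.twist g ψ = BIJ85RT33.twist g (c • ψ) := by
    funext x
    simp only [Pi.smul_apply, BIJ85RT33.twist_apply, Complex.real_smul]
    ring
  rw [htw, hρg g v (c • ψ)]

/-- kernel: `𝒮ρ` is jointly measurable with `ρ`. [cite: BalabanImbrieJaffe1988, (5.15.3) p.313] -/
theorem measurable_scaleStep (c : ℝ) {ρ : Dens P i} (hρm : Measurable (uncurry ρ)) : Measurable (uncurry (scaleStep c ρ)) := by
  have h : Measurable fun z : GaugeField P i U1 × HiggsField P i => uncurry ρ (z.1, c • z.2) :=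
    hρm.comp (measurable_fst.prodMk ((measurable_const_smul c).comp measurable_snd))
  exact (measurable_const.mul h :)

/-- kernel: `𝒮ρ` is `dv dψ`-integrable with `ρ` (`c ≠ 0`: `ψ ↦ cψ` maps Lebesgue measure to a multiple of itself).
[cite: BalabanImbrieJaffe1988, (5.15.3) p.313] -/
theorem integrable_scaleStep {c : ℝ} (hc : 0 < c) {ρ : Dens P i} (hρi : Integrable (uncurry ρ) ((fieldMeasure P i U1).prod volume)) :
    Integrable (uncurry (scaleStep c ρ)) ((fieldMeasure P i U1).prod volume) := by
  -- `T : (v, ψ) ↦ (v, cψ)` pushes `dv dψ` to `|c^{−2|T|}| • dv dψ`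
  set T : GaugeField P i U1 × HiggsField P i → GaugeField P i U1 × HiggsField P i := fun z => (z.1, c • z.2) with hT
  have hmeas : Measurable T := measurable_fst.prodMk ((measurable_const_smul c).comp measurable_snd)
  have hmap : ((fieldMeasure P i U1).prod (volume : Measure (HiggsField P i))).map T =
      ENNReal.ofReal |(c ^ Module.finrank ℝ (HiggsField P i))⁻¹| • (fieldMeasure P i U1).prod volume := by
    have h1 : T = Prod.map id (fun ψ : HiggsField P i => c • ψ) := rfl
    rw [h1, ← Measure.map_prod_map _ _ measurable_id (measurable_const_smul c), Measure.map_id,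
      Measure.map_addHaar_smul volume hc.ne', Measure.prod_smul_right]
  have hac : ((fieldMeasure P i U1).prod (volume : Measure (HiggsField P i))).map T ≪ (fieldMeasure P i U1).prod volume := by
    rw [hmap]
    exact Measure.smul_absolutelyContinuous
  have hsm : Integrable (uncurry ρ) (((fieldMeasure P i U1).prod (volume : Measure (HiggsField P i))).map T) := by
    rw [hmap]
    exact hρi.smul_measure ENNReal.ofReal_ne_top
  have hcomp : Integrable (uncurry ρ ∘ T) ((fieldMeasure P i U1).prod volume) :=
    (integrable_map_measure (hρi.aestronglyMeasurable.mono_ac hac) hmeas.aemeasurable).1 hsm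
  have e : uncurry (scaleStep c ρ) = fun z => ((c ^ Module.finrank ℝ (HiggsField P i) : ℝ) : ℂ) * (uncurry ρ ∘ T) z := by
    funext z
    rfl
  rw [e]
  exact hcomp.const_mul _

/-- **The Jacobian of the printed substitution is `e^{−E^{(0)′}}` with the exponent of (3.42)**: for `c = L^{−(d−2)/2}`,
`c^{2|T₁|} = exp[−(d−2)(log L)|T₁|] = exp(−E0prime d L |T₁|)` (r18's `BIJ88Sect3Statements.E0prime` = (3.42)) — the block-field contribution
to the normalization energy when the L-lattice of blocks is rescaled to unit spacing. [cite: BalabanImbrieJaffe1988, (3.42) p.273] -/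
theorem scaleJac_eq_exp_neg_E0prime {L : ℝ} (hL : 0 < L) (d n : ℕ) :
    (L ^ (-(((d : ℝ) - 2) / 2))) ^ (2 * n) = Real.exp (-E0prime d L n) := by
  rw [← Real.rpow_natCast, ← Real.rpow_mul hL.le, Real.rpow_def_of_pos hL, E0prime]
  congr 1
  push_cast
  ring

/-- **Transcript note (kernel witness; HOME/GAPS.md G-C2-08).**  (5.15.3) p. 313 prints the increment `((d−2)/2)(log L)|T₁^{(k+1)}|` (and the
prefactor `exp[−((d−2)/2)(log L)|T₁^{(k+1)}|]` in the definition of `ρ(v, ψ¹)`), whereas (3.42)–(3.43) p. 273 — its `k = 0` instance — print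
`E^{(0)′} = (d−2)(log L)|T₁^{(1)}|`, which is what the Jacobian of `ψ^L = L^{−(d−2)/2}ψ¹` on the COMPLEX block field gives
(`scaleJac_eq_exp_neg_E0prime`): for `d ≠ 2`, `L > 1` and a nonempty lattice the two factors differ.  The typed scaling `scaleStep` carries
the honest Jacobian; nothing else depends on the constant. [cite: BalabanImbrieJaffe1988, (5.15.3) p.313] -/
theorem scaleJac_ne_printed5153 {L : ℝ} (hL : 1 < L) {d n : ℕ} (hd : d ≠ 2) (hn : 0 < n) :
    Real.exp (-(((d : ℝ) - 2) / 2 * Real.log L * n)) ≠ Real.exp (-E0prime d L n) := by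
  rw [Ne, Real.exp_eq_exp, E0prime, neg_inj]
  intro h
  have hlog : 0 < Real.log L := Real.log_pos hL
  have hn' : (0 : ℝ) < n := by exact_mod_cast hn
  have hd' : (d : ℝ) - 2 ≠ 0 := by
    intro h0
    apply hd
    have h2 : (d : ℝ) = 2 := by linarith
    exact_mod_cast h2
  have hzero : ((d : ℝ) - 2) * Real.log L * n = 0 := by linarith
  rcases mul_eq_zero.1 hzero with h1 | h1
  · rcases mul_eq_zero.1 h1 with h2 | h2
    · exact hd' h2
    · exact hlog.ne' h2
  · exact hn'.ne' h1

/-- **The full renormalization step `R = 𝒮𝒯`** of [BalabanImbrieJaffe1985] (3.1)–(3.2) at level `i`: one transformation step followed by the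
scaling of the block scalar field (printed `c = L^{−(d−2)/2}`). [cite: BalabanImbrieJaffe1985, (3.2) p.306] -/
def rgStep (hi : i + 1 ≤ P.m + P.K) {a : ℝ} (ha : 0 < a) (hd : 2 ≤ P.d) (c : ℝ) (ρ : Dens P i) : Dens P (i + 1) :=
  scaleStep c (rtStep hi ha hd ρ)

/-- **`R = 𝒮𝒯` preserves measurability, joint gauge invariance, integrability, and the total integral** ((3.7): *"∫𝒯e^{−S}𝒟v𝒟ψ =
∫e^{−S}𝒟u𝒟φ"* composed with p. 313 *"the integral of ρ(v, ψ¹) is equal to the integral of ρ^L(v, ψ^L)"*), for every `c > 0`.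
[cite: BalabanImbrieJaffe1985, (3.7) p.306] -/
theorem rgStep_regular (hi : i + 1 ≤ P.m + P.K) {a : ℝ} (ha : 0 < a) (hd : 2 ≤ P.d) {c : ℝ} (hc : 0 < c) {ρ : Dens P i}
    (hρm : Measurable (uncurry ρ)) (hρg : JointInvariant ρ) (hρi : Integrable (uncurry ρ) ((fieldMeasure P i U1).prod volume)) :
    Measurable (uncurry (rgStep hi ha hd c ρ)) ∧ JointInvariant (rgStep hi ha hd c ρ) ∧
      Integrable (uncurry (rgStep hi ha hd c ρ)) ((fieldMeasure P (i+1) U1).prod volume) ∧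
      ∫ v, ∫ ψ, rgStep hi ha hd c ρ v ψ ∂volume ∂fieldMeasure P (i+1) U1 = ∫ U, ∫ φ, ρ U φ ∂volume ∂fieldMeasure P i U1 :=
  ⟨measurable_scaleStep c (measurable_rtStep hi ha hd),
    jointInvariant_scaleStep c (jointInvariant_rtStep hi ha hd),
    integrable_scaleStep hc (integrable_rtStep hi ha hd hρm hρg hρi),
    (integral_integral_scaleStep hc _).trans (integral_rtStep hi ha hd hρm hρg hρi)⟩

end Scale

/-! ## §6 (v1.2) `R = 𝒮_L𝒯` iterated: [BalabanImbrieJaffe1985] (3.1)–(3.2) `R : S → S^{(1)}` applied `k` times (Sect. 4 p. 309) -/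

/-- **`R^k`**: the full renormalization step `R = 𝒮𝒯` ((3.2); `rgStep` with the Gaussian parameter `a_n` and the scalar-field scaling `c_n` of
the `n`-th step, printed `c = L^{−(d−2)/2}`) iterated from level `j` to level `j + k` — p. 309: *"the action which is produced after k
renormalization transformations"*, at density level. [cite: BalabanImbrieJaffe1985, (3.1) p.306] -/
def rgIter (a : ℕ → ℝ) (ha : ∀ n, 0 < a n) (hd : 2 ≤ P.d) (c : ℕ → ℝ) (ρ₀ : Dens P j) :
    (k : ℕ) → j + k ≤ P.m + P.K → Dens P (j + k)
  | 0, _ => ρ₀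
  | k + 1, hk => rgStep (i := j + k) hk (ha k) hd (c k) (rgIter a ha hd c ρ₀ k (Nat.le_of_succ_le hk))

section RGIter

variable (a : ℕ → ℝ) (ha : ∀ n, 0 < a n) (hd : 2 ≤ P.d) (c : ℕ → ℝ) {ρ₀ : Dens P j}

/-- kernel: the `(k+1)`-st iterate of `R` is `R` applied to the `k`-th. [cite: BalabanImbrieJaffe1985, (3.1) p.306] -/
theorem rgIter_succ (k : ℕ) (hk : j + (k + 1) ≤ P.m + P.K) :
    rgIter a ha hd c ρ₀ (k + 1) hk = rgStep (i := j + k) hk (ha k) hd (c k) (rgIter a ha hd c ρ₀ k (Nat.le_of_succ_le hk)) := rfl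

/-- **`R^k e^{−S}` is an honest density with the same total integral**: for `ρ₀` jointly measurable, jointly gauge invariant and `𝒟u𝒟φ`-integrable
and all `a_n, c_n > 0`, every iterate `R^kρ₀` is jointly measurable, EXACTLY jointly gauge invariant, `dv dψ`-integrable, and
`∫dv dψ (R^kρ₀)(v, ψ) = ∫𝒟u𝒟φ ρ₀(u, φ)` ((3.7) and p. 313 composed `k` times). [cite: BalabanImbrieJaffe1985, (3.7) p.306] -/
theorem rgIter_regular (hc : ∀ n, 0 < c n) (hρm : Measurable (uncurry ρ₀)) (hρg : JointInvariant ρ₀)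
    (hρi : Integrable (uncurry ρ₀) ((fieldMeasure P j U1).prod volume)) (k : ℕ) (hk : j + k ≤ P.m + P.K) :
    Measurable (uncurry (rgIter a ha hd c ρ₀ k hk)) ∧ JointInvariant (rgIter a ha hd c ρ₀ k hk) ∧
      Integrable (uncurry (rgIter a ha hd c ρ₀ k hk)) ((fieldMeasure P (j + k) U1).prod volume) ∧
      ∫ v, ∫ ψ, rgIter a ha hd c ρ₀ k hk v ψ ∂volume ∂fieldMeasure P (j + k) U1 = ∫ U, ∫ φ, ρ₀ U φ ∂volume ∂fieldMeasure P j U1 := by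
  induction k with
  | zero => exact ⟨hρm, hρg, hρi, rfl⟩
  | succ k ih =>
    obtain ⟨hm, hg, hint, hI⟩ := ih (Nat.le_of_succ_le hk)
    obtain ⟨hm', hg', hint', hI'⟩ := rgStep_regular hk (ha k) hd (hc k) hm hg hint
    exact ⟨hm', hg', hint', hI'.trans hI⟩

/-- **`[F] = ∫dv dψ (R^kρ₀)(v, ψ)` for the model** (`ρ₀ = F e^{−S}` = r18's `rho0`, every (3.1) observable `F`: jointly measurable, jointly gauge
invariant, `|F(u, φ)| ≤ CΠ_x(1 + |φ(x)|)ⁿ`; `ε > 0`, `λ > 0`, `a_n, c_n > 0`, `d ≥ 2`, `j + k ≤ m + K`) — the unnormalized expectation is carried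
unchanged through `k` full renormalization steps `R = 𝒮𝒯`. [cite: BalabanImbrieJaffe1988, (4.1) p.274] -/
theorem bracket_eq_integral_rgIter (hc : ∀ n, 0 < c n) {ε : ℝ} (hε : 0 < ε) (e : ℝ) {lam : ℝ} (hlam : 0 < lam) (dm2 E₀ E₁ : ℝ)
    {F : GaugeField P j U1 → HiggsField P j → ℂ} (hFm : Measurable (uncurry F)) (hFg : JointInvariant F) {C : ℝ} {n : ℕ}
    (hF : ∀ U φ, ‖F U φ‖ ≤ C * ∏ x : Balaban1983to89.Site P j, (1 + ‖φ x‖) ^ n) (k : ℕ) (hk : j + k ≤ P.m + P.K) :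
    bracket (actionU1 (ε ^ P.d) ε⁻¹ e lam dm2 E₀ E₁) F =
      ∫ v, ∫ ψ, rgIter a ha hd c (rho0 ε e lam dm2 E₀ E₁ F) k hk v ψ ∂volume ∂fieldMeasure P (j + k) U1 := by
  rw [bracket_eq_integral_rho0 hε, (rgIter_regular a ha hd c hc (measurable_rho0 ε e lam dm2 E₀ E₁ hFm)
    (fun g U φ => rho0_gaugeAct ε e lam dm2 E₀ E₁ hFg g U φ) (BIJ88Rho0Integrable.integrable_rho0 hε e hlam dm2 E₀ E₁ hFm hF) k hk).2.2.2]

end RGIter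

end

end Literature.MathematicalPhysics.QuantumFieldTheory.BalabanImbrieJaffe1984to88.BIJ88RTIterated
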